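import Mathlib
import Summits.Ventures.HodgeRepro.PeriodCloserC7Lift

/-!
# Tier4/LitLocalTheta — the local theta lifts `U(W) → U(V)`, `dim W = 2`, `dim V = 3`, AS PRINTED (Gan–Ichino, Mínguez)

Blind re-derivation cell `pub-hodge-repro`, Tier 4, seat `t4-lit-6` (gen 0).  Target tree path
`lean/Summits/Ventures/HodgeRepro/Tier4/LitLocalTheta.lean`.  Named Props = printed statements with their hypotheses
explicit; NO published theorem is proved (seat rule); the theorem at the end is a composition.  Quotes with page/line:
HOME/proofs/t4/inputs/t4-lit-6.md rows I-t4-lit-6-16 (Mínguez) and -19 (Gan–Ichino).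

Sources.  [GI16] W. T. Gan, A. Ichino, *The Gross–Prasad conjecture and local theta correspondence*, Invent. Math.
206 (2016) 705–799 — read on the arXiv text `paper:arxiv-1409.6824` (AUTHOR COPY; print not held), §4.5 Theorem 4.4
(p0010:L108–p0011:L23; the text layer drops the symbols `Θ`, `χ_V`, `χ_W`, `Π_φ`, reconstructed from §4.1–§4.2):
«Almost equal rank case.  Now we consider the case `dim V = n+1` and `dim W = n`. … Theorem 4.4.  Let `φ` be an
`L`-parameter for `U(W_n)`.  Then we have: (i) Suppose that `φ` does not contain `χ_V`.  (a) For any `π ∈ Π^{ε′}_φ`,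
`Θ_{ψ,V^ε_{n+1},W^{ε′}_n}(π)` is nonzero and `θ_{ψ,V^ε_{n+1},W^{ε′}_n}(π)` has `L`-parameter
`θ(φ) = (φ ⊗ χ_V^{−1} χ_W) ⊕ χ_W`.  (b) For each `ε = ±1`, the theta correspondence `π ↦ θ(π)` gives a bijection
`Π_φ → Π^ε_{θ(φ)}`.  (ii) Suppose that `φ` contains `χ_V`.  (a) For any fixed `π ∈ Π^{ε′}_φ`, exactly one of
`Θ_{ψ,V^+_{n+1},W^{ε′}_n}(π)` or `Θ_{ψ,V^−_{n+1},W^{ε′}_n}(π)` is nonzero.  (b) If `Θ(π)` is nonzero, then `θ(π)` has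
`L`-parameter `θ(φ) = (φ ⊗ χ_V^{−1} χ_W) ⊕ χ_W`.  (c) The theta correspondence gives a bijection `Π_φ → Π_{θ(φ)}`.
(iii) If `φ` is tempered and `Θ(π)` is nonzero, then `Θ(π)` is irreducible.»  (`E/F` a quadratic extension of
NON-ARCHIMEDEAN local fields throughout [GI16] §4; `V^±_{n+1}` the two hermitian spaces of dimension `n+1`;
`Θ` the big theta = the partner of the maximal `π`-isotypic quotient of the Weil representation, p0010:L32–L36.)
[Mi08] A. Mínguez, *Correspondance de Howe explicite : paires duales de type II*, Ann. Sci. ÉNS 41 (2008) 717–741 —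
HELD NUMDAM PRINT `paper:doi-10-24033-asens-2080`, Théorème 1 p. 718 (p0003:L36–L50): «Soit `π` une représentation
lisse irréductible de `G_n`.  1. Si `Hom_{G_n}(ω_{n,m}, π) ≠ 0`, alors il existe une unique représentation lisse
irréductible `π′` de `G_m` telle que `Hom_{G_n×G_m}(ω_{n,m}, π ⊗ π′) ≠ 0`.  De plus, `dim(Hom_{G_n×G_m}(ω_{n,m}, π ⊗ π′))
= 1`.  2. Supposons `n ≤ m`.  Alors `Hom_{G_n}(ω_{n,m}, π) ≠ 0` …» (`G_n = GL_n(D)`, `ω_{n,m}` the Weil representation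
of the type II pair on `𝒮(M_{n,m})`, (1.4) pp. 721–722 — at a place of `E′⁺` SPLIT in `E′` the unitary pair
`(U(W_v), U(V_v))` is the type II pair `(GL_2, GL_3)`, `n = 2 ≤ m = 3`).

WHAT IS BUILT INTO THE TYPINGS (README §9).  The places of the face interface carry `I.IsSplit` (night-2); the new
interface adds `IsArch` (the archimedean places — [GI16] §4 does not cover them; the real places are t4-lit-2's
Paul 1998 / Konno–Konno rows), `ParamContainsChiV v τ` («the `L`-parameter of `τ_v` contains `χ_V`»), `IsTempered v τ`,
and `localLiftNonzeroOther v τ` (the lift of `τ_v` to the OTHER hermitian 3-space `V_v^{−ε}`), while the lift to the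
route's own `V_v` is `J.localLiftNonzero v τ` (night-2's `LiftInterface`).  `τ_v` ranges over the local components of
`τ : I.Tau` (every `π` of a Vogan packet is covered by quantifying over `τ`).  The Mínguez statement is used only
through its clause 2 («`Hom ≠ 0`» = the big theta is non-zero) at the split places.  Nothing here says anything about
the status of the Hodge conjecture for CM abelian varieties, which is NOT proved.
-/

set_option autoImplicit false

noncomputable section

namespace Summit.Ventures.HodgeRepro.Tier4.Lit

open NumberField
open Summit.Ventures.HodgeRepro.PeriodCloser

variable {L : Type} [Field L] [NumberField L] [IsCMField L]

/-- **The local-theta interface** on top of night-2's `LiftInterface`: the archimedean places, the parameter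
condition «`φ_{τ_v}` contains `χ_V`», temperedness, and the lift to the other hermitian 3-space. -/
structure LocalThetaInterface (I : C7Face L) (J : LiftInterface I) where
  /-- `v` is archimedean (not covered by [GI16] §4 / [Mi08]) -/
  IsArch : I.Place → Prop
  /-- the `L`-parameter of `τ_v` contains the splitting character `χ_{V,v}` -/
  ParamContainsChiV : I.Place → I.Tau → Prop
  /-- `τ_v` is tempered -/
  IsTempered : I.Place → I.Tau → Prop
  /-- the local theta lift of `τ_v` to the OTHER hermitian 3-space `V_v^{−ε}` is non-zero -/
  localLiftNonzeroOther : I.Place → I.Tau → Prop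

/-- **[GI16] Theorem 4.4 (i)(a)** at a non-archimedean, non-split place: if the parameter of `τ_v` does not contain
`χ_V`, the big theta lift of `τ_v` to BOTH hermitian 3-spaces is non-zero. -/
def GanIchino2016_Thm4_4_i (I : C7Face L) (J : LiftInterface I) (T : LocalThetaInterface I J) : Prop :=
  ∀ v : I.Place, ¬ T.IsArch v → ¬ I.IsSplit v → ∀ τ : I.Tau,
    ¬ T.ParamContainsChiV v τ → (J.localLiftNonzero v τ ∧ T.localLiftNonzeroOther v τ)

/-- **[GI16] Theorem 4.4 (ii)(a)** at a non-archimedean, non-split place: if the parameter of `τ_v` contains `χ_V`,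
exactly one of the two lifts is non-zero. -/
def GanIchino2016_Thm4_4_ii (I : C7Face L) (J : LiftInterface I) (T : LocalThetaInterface I J) : Prop :=
  ∀ v : I.Place, ¬ T.IsArch v → ¬ I.IsSplit v → ∀ τ : I.Tau,
    T.ParamContainsChiV v τ → (J.localLiftNonzero v τ ↔ ¬ T.localLiftNonzeroOther v τ)

/-- **[Mi08] Théorème 1, clause 2** at a split non-archimedean place (`(U(W_v), U(V_v)) = (GL_2, GL_3)`,
`n = 2 ≤ m = 3`): `Hom_{G_n}(ω_{n,m}, π) ≠ 0` for EVERY irreducible smooth `π` — the big theta lift of `τ_v` is non-zero. -/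
def Minguez2008_Thm1_split (I : C7Face L) (J : LiftInterface I) (T : LocalThetaInterface I J) : Prop :=
  ∀ v : I.Place, ¬ T.IsArch v → I.IsSplit v → ∀ τ : I.Tau, J.localLiftNonzero v τ

/-- **Hypothesis — the parameter condition is dodged on admissible data** (the route's reading of [GI16] Thm 4.4:
«a tempered `τ_v` lifts to BOTH pure inner forms of the 3-space unless `γ_{V,v} ∈ {…}`, and the route dodges the two
values by a local twist of `γ_V` realised globally», ROUTE.md §4 item 2 (9)(e)): for every admissible datum, at every
non-archimedean non-split place the parameter of `Θ(β)_v` does not contain `χ_V`.  A LINE'S hypothesis, never a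
theorem of a held page. -/
def ParamDodged (I : C7Face L) (J : LiftInterface I) (T : LocalThetaInterface I J) : Prop :=
  ∀ d : I.Datum, I.Admissible d → ∀ v : I.Place, ¬ T.IsArch v → ¬ I.IsSplit v →
    ¬ T.ParamContainsChiV v (I.thetaLift (I.betaOf d))

/-- **Hypothesis — the archimedean local lifts** (t4-lit-2's family: Paul 1998 / Konno–Konno 2007 / the route's
(E5) `K`-type table): for every admissible datum the lift of `Θ(β)_v` is non-zero at every archimedean place. -/
def ArchLiftsNonzero (I : C7Face L) (J : LiftInterface I) (T : LocalThetaInterface I J) : Prop :=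
  ∀ d : I.Datum, I.Admissible d → ∀ v : I.Place, T.IsArch v → J.localLiftNonzero v (I.thetaLift (I.betaOf d))

/-- Composition (no published content): night-2's route-derived `PeriodCloserC7Lift.LocalLiftsNonzero` from its
printed sources — [GI16] Thm 4.4 (i)(a) at the non-split finite places (under the dodging hypothesis), [Mi08] Thm 1
at the split finite places, and the archimedean hypothesis. -/
theorem LocalLiftsNonzero.ofPrinted (I : C7Face L) (J : LiftInterface I) (T : LocalThetaInterface I J)
    (hGI : GanIchino2016_Thm4_4_i I J T) (hMi : Minguez2008_Thm1_split I J T) (hdodge : ParamDodged I J T)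
    (harch : ArchLiftsNonzero I J T) : LocalLiftsNonzero I J := by
  intro d hd v
  by_cases ha : T.IsArch v
  · exact harch d hd v ha
  · by_cases hs : I.IsSplit v
    · exact hMi v ha hs _
    · exact (hGI v ha hs _ (hdodge d hd v ha hs)).1

end Summit.Ventures.HodgeRepro.Tier4.Lit

end
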